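import Mathlib
import Summits.Ventures.FusionMHD.Models.RwmFRS1
import Summits.Ventures.FusionMHD.Models.RwmFRS1Kq07
import Literature.MathematicalPhysics.MHD.NewcombResonantAlgebraicCertificates
import HarnessLib

/-!
# F3 row «F3.σ-NEWCOMB-RES21-FRS1»: the RESONANT helicity `(m, n) = (2, 1)` of MODEL M_RWM (`RwmFRS1.P`, `q = 2` at `r_s = √(3/7)` inside the plasma) — internal AND external Newcomb verdicts WITHOUT SOLVING, from supersolutions on the two pieces and four polynomial sign facts (lit-4's `NewcombResonantAlgebraicCertificates`)

LADDER-GRIDFUSION rung F3 (cell `gridfusion`): statements + proofs by gridfusion-lit-4 g11 (template `HOME/lean/lit-4/templates/NewcombRes21FRS1.lean`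
9855df62f3ab13ef (re-staged form of 5433463a62f9337f), OFFER B, INBOX 2026-08-28T01:21Z / 01:34:59Z; lead g10 RULING 9dz (3) / 9ec (b) «booked AT ACCEPT
when a model seat files it»); FILED UNCHANGED but for hygiene (imports `Mathlib`/`HarnessLib` first, this module docstring, a one-line docstring on every
declaration that had none; and the template's `Res21.k0Sq_eq` DROPPED in favour of the identical landed `Kq07.k0Sq_eq` (gate dedup), hence the extra
import `RwmFRS1Kq07`) by gridfusion-model-7 g7, 2026-08-28.  Every other declaration, statement and proof below is lit-4's, byte-identical.  MODELLED:
MODEL M_RWM (RwmFRS1.P: B_z ≡ 1, B_θ = r/(7(1+r²)), p ≡ 0, μ₀ = 1, a = 1, k = −1/5; q = (7/5)(1+r²)); straight periodic cylinder, ideal MHD, single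
helicity (2,1) with its resonant surface INSIDE the plasma; internal verdict = Newcomb's Theorems 3/7/12 on the admissible class (11.115), external =
(11.118) for every wall factor Λ ≥ 0; supersolutions w₁ = w₂ = r (inner piece), w ≡ 1 (outer piece); nothing about a device; 0 kit. [instance data]
Citations: Freidberg 2014 §11.5.3 (11.110)–(11.118) [Freidberg2014]; Hartman 2002 Ch. XI §3 [Hartman2002].

lit-4's template header, verbatim:

> TEMPLATE (gridfusion lit-4 g11, 2026-08-28): «F3.σ-NEWCOMB-RES-ALGEBRAIC-FRS1-21» — the RESONANT helicity (m, n) = (2, 1) of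
> MODEL M_RWM (RwmFRS1.P: B_z ≡ 1, B_θ = r/(7(1+r²)), p ≡ 0, μ₀ = 1, a = 1, k = −1/5; q = (7/5)(1+r²) = 2 at
> r_s = √(3/7) INSIDE the plasma) decided WITHOUT SOLVING: internal (Newcomb Theorems 3/7/12) and external ((11.118), any
> Λ ≥ 0) verdicts from the supersolutions w₁ = w₂ = r on the inner piece, w ≡ 1 on the outer piece, and four polynomial
> sign facts.  Compiles against the tree after p592738.  Model seats: move into your namespace / Models file; nothing here
> is booked or filed by lit-4.
-/

noncomputable section

open Set Literature.MathematicalPhysics.MHD Literature.MathematicalPhysics.MHD.ScrewPinch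

namespace Summit.Ventures.FusionMHD.Models

namespace RwmFRS1

namespace Res21

/-! ### The (2,1) helicity of M_RWM: closed forms -/

/-- The resonant radius `r_s = √(3/7)` (`q(r_s) = 2`). [instance data] -/
def rs : ℝ := Real.sqrt (3 / 7)

/-- `rs_pos`: `: 0 < rs`. [instance data] -/
theorem rs_pos : 0 < rs := Real.sqrt_pos.2 (by norm_num)

/-- `rs_sq`: `: rs ^ 2 = 3 / 7`. [instance data] -/
theorem rs_sq : rs ^ 2 = 3 / 7 := Real.sq_sqrt (by norm_num)

/-- `rs_lt_one`: `: rs < 1`. [instance data] -/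
theorem rs_lt_one : rs < 1 := by
  have h : rs ^ 2 < 1 ^ 2 := by rw [rs_sq]; norm_num
  exact lt_of_pow_lt_pow_left₀ 2 (by norm_num) h

/-- `sq_lt_of_lt_rs`: `{r : ℝ} (hr : 0 < r) (h : r < rs) : r ^ 2 < 3 / 7`. [instance data] -/
theorem sq_lt_of_lt_rs {r : ℝ} (hr : 0 < r) (h : r < rs) : r ^ 2 < 3 / 7 := by
  rw [← rs_sq]; exact pow_lt_pow_left₀ h hr.le two_ne_zero

/-- `lt_sq_of_rs_lt`: `{r : ℝ} (h : rs < r) : 3 / 7 < r ^ 2`. [instance data] -/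
theorem lt_sq_of_rs_lt {r : ℝ} (h : rs < r) : 3 / 7 < r ^ 2 := by
  rw [← rs_sq]; exact pow_lt_pow_left₀ h rs_pos.le two_ne_zero

/-- `F = kB_z + mB_θ/r = (3 − 7r²)/(35(1+r²))` for `(m, k) = (2, −1/5)` (`r ≠ 0`). [cite: Freidberg2014, §11.5.1 eq. (11.90)] -/
theorem kDotB_eq {r : ℝ} (hr : r ≠ 0) : P.kDotB 2 kk r = (3 - 7 * r ^ 2) / (35 * (1 + r ^ 2)) := by
  have h1 : (0 : ℝ) < 1 + r ^ 2 := by positivity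
  rw [ScrewPinch.Profile.kDotB, P_Bθ, P_Bz, kk]
  field_simp
  ring

/-- `F† = −(17 + 7r²)/(35(1+r²))` (`r ≠ 0`). [cite: Freidberg2014, §11.5.1 eq. (11.89)] -/
theorem kDotBDagger_eq {r : ℝ} (hr : r ≠ 0) : P.kDotBDagger 2 kk r = -(17 + 7 * r ^ 2) / (35 * (1 + r ^ 2)) := by
  have h1 : (0 : ℝ) < 1 + r ^ 2 := by positivity
  rw [ScrewPinch.Profile.kDotBDagger, P_Bθ, P_Bz, kk]
  field_simp
  ring

/-- `f = r³(3−7r²)²/(49(1+r²)²(r²+100))` (`r ≠ 0`). [cite: Freidberg2014, §11.5.1 eq. (11.90)] -/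
theorem newcombF_eq {r : ℝ} (hr : r ≠ 0) :
    P.newcombF 2 kk r = r ^ 3 * (3 - 7 * r ^ 2) ^ 2 / (49 * (1 + r ^ 2) ^ 2 * (r ^ 2 + 100)) := by
  have h1 : (0 : ℝ) < 1 + r ^ 2 := by positivity
  have h2 : (0 : ℝ) < r ^ 2 + 100 := by positivity
  rw [ScrewPinch.Profile.newcombF, kDotB_eq hr, Kq07.k0Sq_eq hr]
  field_simp
  ring

/-- The cubic `G(s) = (3−7s)(s+75)(s+100) − 50s(17+7s) = 22500 − 52825s − 1572s² − 7s³` of the numerator of `g`. [instance data] -/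
def G (s : ℝ) : ℝ := 22500 - 52825 * s - 1572 * s ^ 2 - 7 * s ^ 3

/-- `G_eq`: `(s : ℝ) : G s = (3 - 7 * s) * (s + 75) * (s + 100) - 50 * s * (17 + 7 * s)`. [instance data] -/
theorem G_eq (s : ℝ) : G s = (3 - 7 * s) * (s + 75) * (s + 100) - 50 * s * (17 + 7 * s) := by unfold G; ring

/-- `g = r(3−7r²)G(r²)/(1225(1+r²)²(r²+100)²)` (`p′ = 0`, `r ≠ 0`). [cite: Freidberg2014, §11.5.1 eq. (11.90)] -/
theorem newcombG_eq {r : ℝ} (hr : r ≠ 0) :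
    P.newcombG 2 kk r = r * (3 - 7 * r ^ 2) * G (r ^ 2) / (1225 * (1 + r ^ 2) ^ 2 * (r ^ 2 + 100) ^ 2) := by
  have h1 : (0 : ℝ) < 1 + r ^ 2 := by positivity
  have h2 : (0 : ℝ) < r ^ 2 + 100 := by positivity
  have hp : deriv P.p r = 0 := by
    rw [show P.p = fun _ => (0 : ℝ) from funext P_p, deriv_const]
  rw [ScrewPinch.Profile.newcombG, hp, kDotB_eq hr, kDotBDagger_eq hr, Kq07.k0Sq_eq hr, G, kk, P_μ₀]
  field_simp
  ring

/-- `F(r_s) = 0`. [instance data] -/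
theorem kDotB_rs : P.kDotB 2 kk rs = 0 := by
  rw [kDotB_eq rs_pos.ne', rs_sq]; norm_num

/-- `F ≠ 0` on `(0, r_s)`. [instance data] -/
theorem kDotB_ne_zero_in {r : ℝ} (hr : r ∈ Ioo 0 rs) : P.kDotB 2 kk r ≠ 0 := by
  rw [kDotB_eq hr.1.ne']
  have h1 : (0 : ℝ) < 1 + r ^ 2 := by positivity
  have := sq_lt_of_lt_rs hr.1 hr.2
  exact div_ne_zero (by nlinarith) (by positivity)

/-- `F ≠ 0` on `(r_s, 1]` (indeed for all `r > r_s`). [instance data] -/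
theorem kDotB_ne_zero_out {r : ℝ} (hr : rs < r) : P.kDotB 2 kk r ≠ 0 := by
  rw [kDotB_eq (rs_pos.trans hr).ne']
  have h1 : (0 : ℝ) < 1 + r ^ 2 := by positivity
  have := lt_sq_of_rs_lt hr
  exact div_ne_zero (by nlinarith) (by positivity)

/-- `f′` in closed form. [instance data] -/
def fD (r : ℝ) : ℝ :=
  r ^ 2 * (3 - 7 * r ^ 2) * (900 - 5197 * r ^ 2 - 2144 * r ^ 4 - 7 * r ^ 6) / (49 * (1 + r ^ 2) ^ 3 * (r ^ 2 + 100) ^ 2)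

/-- `f′ = fD` on `r > 0`. [instance data] -/
theorem hasDerivAt_newcombF {r : ℝ} (hr : 0 < r) : HasDerivAt (P.newcombF 2 kk) (fD r) r := by
  have h1 : (0 : ℝ) < 1 + r ^ 2 := by positivity
  have h2 : (0 : ℝ) < r ^ 2 + 100 := by positivity
  have hev : (fun s => s ^ 3 * (3 - 7 * s ^ 2) ^ 2 / (49 * (1 + s ^ 2) ^ 2 * (s ^ 2 + 100))) =ᶠ[nhds r]
      P.newcombF 2 kk := by
    filter_upwards [isOpen_Ioi.mem_nhds hr] with s hs
    rw [newcombF_eq (ne_of_gt hs)]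
  have hd : HasDerivAt (fun s : ℝ => s ^ 3 * (3 - 7 * s ^ 2) ^ 2 / (49 * (1 + s ^ 2) ^ 2 * (s ^ 2 + 100)))
      (((3 * r ^ 2 * (3 - 7 * r ^ 2) ^ 2 + r ^ 3 * (2 * (3 - 7 * r ^ 2) * (-(7 * (2 * r))))) *
          (49 * (1 + r ^ 2) ^ 2 * (r ^ 2 + 100)) -
        r ^ 3 * (3 - 7 * r ^ 2) ^ 2 * (49 * (2 * (1 + r ^ 2) * (2 * r)) * (r ^ 2 + 100) + 49 * (1 + r ^ 2) ^ 2 * (2 * r))) /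
        (49 * (1 + r ^ 2) ^ 2 * (r ^ 2 + 100)) ^ 2) r := by
    have hnum : HasDerivAt (fun s : ℝ => s ^ 3 * (3 - 7 * s ^ 2) ^ 2)
        (3 * r ^ 2 * (3 - 7 * r ^ 2) ^ 2 + r ^ 3 * (2 * (3 - 7 * r ^ 2) * (-(7 * (2 * r))))) r := by
      have ha := hasDerivAt_pow 3 r
      have hb : HasDerivAt (fun s : ℝ => 3 - 7 * s ^ 2) (-(7 * (2 * r))) r := by
        simpa using ((hasDerivAt_pow 2 r).const_mul 7).const_sub 3
      have hb2 := hb.pow 2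
      exact (ha.mul hb2).congr_deriv (by simp only [Pi.pow_apply]; push_cast; ring)
    have hden : HasDerivAt (fun s : ℝ => 49 * (1 + s ^ 2) ^ 2 * (s ^ 2 + 100))
        (49 * (2 * (1 + r ^ 2) * (2 * r)) * (r ^ 2 + 100) + 49 * (1 + r ^ 2) ^ 2 * (2 * r)) r := by
      have hc : HasDerivAt (fun s : ℝ => 1 + s ^ 2) (2 * r) r := by
        simpa using (hasDerivAt_pow 2 r).const_add 1
      have hc2 := (hc.pow 2).const_mul 49
      have he : HasDerivAt (fun s : ℝ => s ^ 2 + 100) (2 * r) r := by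
        simpa using (hasDerivAt_pow 2 r).add_const 100
      exact (hc2.mul he).congr_deriv (by simp only [Pi.pow_apply]; push_cast; ring)
    exact hnum.div hden (by positivity)
  refine (hd.congr_of_eventuallyEq hev.symm).congr_deriv ?_
  unfold fD
  field_simp
  ring

/-- The supersolution equation for `w(r) = r`: `(f · w′)′ = (f · 1)′ = fD`. [instance data] -/
theorem hasDerivAt_fw {r : ℝ} (hr : 0 < r) :
    HasDerivAt (fun x => P.newcombF 2 kk x * deriv (fun y : ℝ => y) x) (fD r) r := by
  have e : (fun x => P.newcombF 2 kk x * deriv (fun y : ℝ => y) x) = P.newcombF 2 kk := by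
    funext x; simp
  rw [e]; exact hasDerivAt_newcombF hr

/-- THE SUPERSOLUTION IDENTITY: `g·r − fD = r⁴(3−7r²)K(r²)/(1225(1+r²)³(r²+100)²)` with
`K(s) = 99600 − 797s − 1404s² − 7s³`. [instance data] -/
theorem super_identity {r : ℝ} (hr : r ≠ 0) :
    P.newcombG 2 kk r * r - fD r
      = r ^ 4 * (3 - 7 * r ^ 2) * (99600 - 797 * r ^ 2 - 1404 * r ^ 4 - 7 * r ^ 6)
          / (1225 * (1 + r ^ 2) ^ 3 * (r ^ 2 + 100) ^ 2) := by
  have h1 : (0 : ℝ) < 1 + r ^ 2 := by positivity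
  have h2 : (0 : ℝ) < r ^ 2 + 100 := by positivity
  rw [newcombG_eq hr, fD, G]
  field_simp
  ring

/-- `w = r` is a SUPERSOLUTION on the whole inner piece: `fD ≤ g·r` on `(0, r_s)`. [instance data] -/
theorem fD_le {r : ℝ} (hr : r ∈ Ioo 0 rs) : fD r ≤ P.newcombG 2 kk r * r := by
  have h := super_identity hr.1.ne'
  have hs := sq_lt_of_lt_rs hr.1 hr.2
  have h1 : (0 : ℝ) < 1 + r ^ 2 := by positivity
  have h2 : (0 : ℝ) < r ^ 2 + 100 := by positivity
  have hK : 0 < 99600 - 797 * r ^ 2 - 1404 * r ^ 4 - 7 * r ^ 6 := by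
    have h4 : r ^ 4 < 1 := by nlinarith
    have h6 : r ^ 6 < 1 := by nlinarith
    nlinarith
  have hpos : 0 ≤ r ^ 4 * (3 - 7 * r ^ 2) * (99600 - 797 * r ^ 2 - 1404 * r ^ 4 - 7 * r ^ 6)
      / (1225 * (1 + r ^ 2) ^ 3 * (r ^ 2 + 100) ^ 2) := by
    apply div_nonneg _ (by positivity)
    have : 0 ≤ 3 - 7 * r ^ 2 := by linarith
    positivity
  linarith

/-- `|fD| ≤ r` on `(0, 1]` (the bound `|q| ≤ Q·w` with `Q = 1`, `w = r`). [instance data] -/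
theorem abs_fD_le {r : ℝ} (hr : 0 < r) (hr1 : r ≤ 1) : |fD r| ≤ 1 * r := by
  have h1 : (0 : ℝ) < 1 + r ^ 2 := by positivity
  have h2 : (0 : ℝ) < r ^ 2 + 100 := by positivity
  have hden : 0 < 49 * (1 + r ^ 2) ^ 3 * (r ^ 2 + 100) ^ 2 := by positivity
  unfold fD
  rw [abs_div, abs_of_pos hden, div_le_iff₀ hden, one_mul]
  have hr2 : r ^ 2 ≤ 1 := by nlinarith
  have hA : |3 - 7 * r ^ 2| ≤ 4 := by rw [abs_le]; constructor <;> nlinarith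
  have hB : |900 - 5197 * r ^ 2 - 2144 * r ^ 4 - 7 * r ^ 6| ≤ 8248 := by
    have h4 : r ^ 4 ≤ 1 := by nlinarith
    have h6 : r ^ 6 ≤ 1 := by nlinarith
    rw [abs_le]; constructor <;> nlinarith
  have hnum : |r ^ 2 * (3 - 7 * r ^ 2) * (900 - 5197 * r ^ 2 - 2144 * r ^ 4 - 7 * r ^ 6)| ≤ r ^ 2 * 4 * 8248 := by
    rw [abs_mul, abs_mul, abs_of_nonneg (sq_nonneg r)]
    have := mul_le_mul hA hB (abs_nonneg _) (by norm_num)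
    nlinarith [sq_nonneg r]
  have hlow : 49 * 1 ^ 3 * 100 ^ 2 ≤ 49 * (1 + r ^ 2) ^ 3 * (r ^ 2 + 100) ^ 2 := by
    gcongr <;> nlinarith [sq_nonneg r]
  nlinarith [sq_nonneg r]

/-- `G < 0` on `[3/7, ∞)`. [instance data] -/
theorem G_neg {s : ℝ} (h0 : 3 / 7 ≤ s) : G s < 0 := by
  unfold G; nlinarith [sq_nonneg s]

/-- `g ≥ 0` on `(r_s, 1)` (both factors `3 − 7r²` and `G(r²)` negative). [instance data] -/
theorem newcombG_nonneg_out {r : ℝ} (hr : r ∈ Ioo rs 1) : 0 ≤ P.newcombG 2 kk r := by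
  have hr0 : 0 < r := rs_pos.trans hr.1
  rw [newcombG_eq hr0.ne']
  have hs := lt_sq_of_rs_lt hr.1
  have hG := G_neg hs.le
  apply div_nonneg _ (by positivity)
  have h3 : 3 - 7 * r ^ 2 < 0 := by linarith
  have := mul_pos_of_neg_of_neg h3 hG
  nlinarith

/-! ### The verdicts -/

/-- **INTERNAL `(2,1)` MODES OF MODEL M_RWM ARE STABLE although `q = 2` lies inside the plasma** — Newcomb's procedure with
ONE resonant surface (Freidberg's summary conditions (2)–(3)) decided WITHOUT SOLVING: every admissible displacement
(`C¹` on `(−51/50, 51/50)` off `r_s`, `ξ(1) = 0`, finite energy (11.115)) has reduced energy `≥ 0`, and `> 0` unless it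
vanishes on `(r_s, 1]`.  MODELLED: straight cylinder, ideal MHD, zero β; nothing about a device. [instance data] -/
theorem internal_stable_21 :
    ∀ ξ : ℝ → ℝ, ContDiffOn ℝ 1 ξ (Ioo (-(51 / 50)) (51 / 50) \ {rs}) → ξ 1 = 0 → P.FiniteEnergyOn 2 kk 0 1 ξ →
      0 ≤ P.fluidEnergy 2 kk 1 ξ ∧ ((∃ r ∈ Ioc rs 1, ξ r ≠ 0) → 0 < P.fluidEnergy 2 kk 1 ξ) := by
  obtain ⟨hBθ, hBz, hp, hBθ0⟩ := profile_regular (51 / 50)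
  have hr₀ : (0 : ℝ) < rs / 2 := by linarith [rs_pos]
  have hr₀ₛ : rs / 2 < rs := by linarith [rs_pos]
  have hODE0 : ∀ r ∈ Ioo rs 1, HasDerivAt (fun x => P.newcombF 2 kk x * deriv (fun _ : ℝ => (1 : ℝ)) x) 0 r := by
    intro r _
    have e : (fun x => P.newcombF 2 kk x * deriv (fun _ : ℝ => (1 : ℝ)) x) = fun _ => 0 := by funext x; simp
    rw [e]; exact hasDerivAt_const r 0
  refine Profile.stable_oneResonance_of_supersolutions (w₁ := fun y => y) (w₂ := fun y => y) (q₁ := fD) (q₂ := fD)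
    (w := fun _ => 1) (q := fun _ => 0) (Q₁ := 1) (Q₂ := 1) (Q := 0) hr₀ hr₀ₛ rs_lt_one (by norm_num) two_ne_zero
    hBθ hBz hp hBθ0 kDotB_rs (fun r hr => kDotB_ne_zero_in hr) (fun r hr => kDotB_ne_zero_out hr.1)
    contDiffOn_id (fun r hr => hr.1) ?_ (fun r hr => abs_fD_le hr.1 (by linarith [hr.2, rs_lt_one]))
    (fun r hr => hasDerivAt_fw hr.1) (fun r hr => fD_le ⟨hr.1, hr.2.trans hr₀ₛ⟩)
    contDiffOn_id (fun r hr => hr₀.trans_le hr.1) ?_ (fun r hr => abs_fD_le (hr₀.trans_le hr.1) (by linarith [hr.2, rs_lt_one]))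
    (fun r hr => hasDerivAt_fw (hr₀.trans hr.1)) (fun r hr => fD_le ⟨hr₀.trans hr.1, hr.2⟩) le_rfl
    contDiffOn_const (fun _ _ => one_pos) continuousOn_const (fun _ _ => by simp) hODE0
    (fun r hr => by simpa using newcombG_nonneg_out hr)
  · have : Continuous fD := by
      unfold fD
      exact Continuous.div (by fun_prop) (by fun_prop) fun x => by positivity
    exact this.continuousOn
  · have : Continuous fD := by
      unfold fD
      exact Continuous.div (by fun_prop) (by fun_prop) fun x => by positivity
    exact this.continuousOn

/-- **EXTERNAL `(2,1)` MODES OF MODEL M_RWM ARE STABLE FOR EVERY WALL FACTOR `Λ ≥ 0`** (resonance inside; (11.118) over the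
last sub-interval with the supersolution `w ≡ 1`: `F F†/k₀²(1) = 24/4949 > 0`): every admissible external displacement (`C¹`
off `r_s`, finite energy, `ξ(1) ≠ 0`) has positive external-mode energy (11.98).  MODELLED: straight cylinder, ideal MHD,
vacuum region and a wall encoded by `Λ`; nothing about a device. [instance data] -/
theorem external_stable_21 {Λ : ℝ} (hΛ : 0 ≤ Λ) :
    ∀ ξ : ℝ → ℝ, ContDiffOn ℝ 1 ξ (Ioo (-(51 / 50)) (51 / 50) \ {rs}) → P.FiniteEnergyOn 2 kk 0 1 ξ →
      ξ 1 ≠ 0 → 0 < P.externalEnergy 2 kk 1 Λ ξ := by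
  obtain ⟨hBθ, hBz, hp, hBθ0⟩ := profile_regular (51 / 50)
  have hr₀ : (0 : ℝ) < rs / 2 := by linarith [rs_pos]
  have hr₀ₛ : rs / 2 < rs := by linarith [rs_pos]
  have hODE0 : ∀ r ∈ Ioo rs 1, HasDerivAt (fun x => P.newcombF 2 kk x * deriv (fun _ : ℝ => (1 : ℝ)) x) 0 r := by
    intro r _
    have e : (fun x => P.newcombF 2 kk x * deriv (fun _ : ℝ => (1 : ℝ)) x) = fun _ => 0 := by funext x; simp
    rw [e]; exact hasDerivAt_const r 0
  have hW : 0 < P.newcombF 2 kk 1 * deriv (fun _ : ℝ => (1 : ℝ)) 1 / (fun _ : ℝ => (1 : ℝ)) 1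
      + (P.kDotB 2 kk 1 * P.kDotBDagger 2 kk 1 / ScrewPinch.Profile.k0Sq 2 kk 1 + 1 ^ 2 * P.kDotB 2 kk 1 ^ 2 * Λ / 2) := by
    rw [kDotB_eq one_ne_zero, kDotBDagger_eq one_ne_zero, Kq07.k0Sq_eq one_ne_zero]
    simp only [deriv_const', mul_zero, zero_div, zero_add]
    norm_num
    positivity
  have hfDc : ContinuousOn fD (Ioc 0 (rs / 2)) ∧ ContinuousOn fD (Ico (rs / 2) rs) := by
    have : Continuous fD := by
      unfold fD
      exact Continuous.div (by fun_prop) (by fun_prop) fun x => by positivity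
    exact ⟨this.continuousOn, this.continuousOn⟩
  exact Profile.externalPos_oneResonance_of_supersolutions (w₁ := fun y => y) (w₂ := fun y => y) (q₁ := fD) (q₂ := fD)
    (w := fun _ => 1) (q := fun _ => 0) (Q₁ := 1) (Q₂ := 1) (Q := 0) hr₀ hr₀ₛ rs_lt_one (by norm_num) two_ne_zero
    hBθ hBz hp hBθ0 kDotB_rs (fun r hr => kDotB_ne_zero_in hr) (fun r hr => kDotB_ne_zero_out hr.1)
    contDiffOn_id (fun r hr => hr.1) hfDc.1 (fun r hr => abs_fD_le hr.1 (by linarith [hr.2, rs_lt_one]))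
    (fun r hr => hasDerivAt_fw hr.1) (fun r hr => fD_le ⟨hr.1, hr.2.trans hr₀ₛ⟩)
    contDiffOn_id (fun r hr => hr₀.trans_le hr.1) hfDc.2 (fun r hr => abs_fD_le (hr₀.trans_le hr.1) (by linarith [hr.2, rs_lt_one]))
    (fun r hr => hasDerivAt_fw (hr₀.trans hr.1)) (fun r hr => fD_le ⟨hr₀.trans hr.1, hr.2⟩) le_rfl
    contDiffOn_const (fun _ _ => one_pos) continuousOn_const (fun _ _ => by simp) hODE0
    (fun r hr => by simpa using newcombG_nonneg_out hr) Λ hW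

end Res21

end RwmFRS1

end Summit.Ventures.FusionMHD.Models

end
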